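import Summits.AtomisticToContinuum.Crystallization.Theorems.PricedLinkCensusTruncatedCensusGapFarPeriodicBlocks

/-!
# The Barlow far-site gap (FAR) is EXACTLY a periodic far-site pricing

Helper (FAR-PERIODIC FORM, part 2 of 2) for the stub `stub_barlowFarSiteGap` (FAR, the open
core) of the line `near-far-split` (`Cruxes/TruncatedCensusGap/Lines/near_far_split.lean`) of
the crux `PricedLinkCensus.TruncatedCensusGap` (item stmt-AtomisticToContinuum-14230); the
FAR-twin of `underCoordinationGap_iff_periodicUnderPricing` (`…UnderCoordinationPeriodicForm.lean`,
class (U) of line `birth`) and of `truncatedCensusGap_iff_periodicPricing` (`…CruxForms.lean`).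
Notation as in part 1 (`…FarPeriodicBlocks.lean`): `V_χ`, `e_χ*`, NEAR-BARLOW sites (the
predicate `∃ a c s g, …` of the stub, spelled out in every statement), `Far(y)` the sites that
are not near-Barlow; the stub (FAR) reads
`∃ κ > 0, ∀ N (y : Fin N → ℝ³) injective, N · e_χ* + κ · #Far(y) ≤ E_χ(y)`.

**Theorem (`farSiteGap_iff_periodicFarPricing`).**  (FAR) is EQUIVALENT to the PERIODIC
FAR-SITE PRICING

  `∃ κ > 0, ∀ Q : PeriodicConfiguration 3, κ · #{motif sites of Q that are far in Q.points}`
  `   ≤ #F · (e_χ(Q) − e_χ*)`.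

So, exactly as for the crux and for the classes (U), (R) of line `birth`, finite clusters, free
surfaces and `N` play no role in (FAR): it is the statement "in Blanc–Lewin's periodic universe,
the excess `V_χ`-energy density of a periodic configuration over the periodic infimum controls,
linearly and uniformly, its density of sites whose `a/2`-separated closed `3a`-patch is NOT
two-way `a/50`-close to a rigidly moved Barlow stacking with `a ∈ [0.93, 1.02]`,
`c/a ∈ [0.78, 0.86]`" — finite-range periodic crystallization for `V_χ` in coarse, priced form
(the open core isolated by the line; Blanc–Lewin 2015, §2.3).  This is the precise open content
of (FAR).

* `⇒` is part 1 (`periodicFarPricing_of_farSiteGap`, blocks);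
* `⇐` (`farSiteGap_of_periodicFarPricing`): far periodisation `y + (8D+8)ℤ³`
  (`ChargedEnergyGapNegative.periodiseFar`); by FAR-LOCALITY (radius `357/100 < 6D + 8`,
  `eq_toPoint_or_far`) its far motif sites are exactly the far sites of `y`
  (`motifFar_periodiseFar`, valid for every `N ≥ 1` — unlike bond counts, the patch predicate
  needs no second point), and its energy per particle is EXACTLY `E_χ(y)/N`
  (`energyPerParticle_periodiseFar_eq_div`, range `2 ≤ 8`); `N = 0` is trivial;
* consequences: the KILL CRITERION `lt_energyPerParticle_of_motifFar` (under (FAR), a periodic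
  configuration with one far motif site is not a periodic `V_χ`-minimiser) and the uniform gap
  `le_energyPerParticle_of_forall_motifFar` (under (FAR), a periodic configuration ALL of whose
  motif sites are far — e.g. every periodic structure nowhere locally Barlow at these
  tolerances — lies at least `κ` above `e_χ*` per particle).

All `[folklore]` bookkeeping; the content of (FAR) is untouched.
-/

noncomputable section

namespace Summit.AtomisticToContinuum.Crystallization.Theorems.PricedLinkCensusTruncatedCensusGap

open Literature.MathematicalPhysics.StatisticalMechanics Literature.Geometry.DiscreteGeometry
open Summit.AtomisticToContinuum.Crystallization.Theorems.ChargedEnergyGapNegative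
open Summit.AtomisticToContinuum.Crystallization.Theorems.ChargedEnergyGapNegative.Blocks

/-! ## The far periodisation: far motif sites are those of `y` -/

section FarPeriodisation

variable {N : ℕ}

/-- Points of the far periodisation `y + (8D+8)ℤ³` within `357/100` of a motif point `yᵢ` are
motif points (the other points are at distance `≥ 6D + 8`). [folklore] -/
theorem mem_range_toPoint_of_dist_le {y : Fin N → E3} (hN : 0 < N) (i : Fin N)
    (q : (periodiseFar y hN).points)
    (hq : dist ((Subtype.val : (periodiseFar y hN).points → EuclideanSpace ℝ (Fin 3)) q) ((Subtype.val : (periodiseFar y hN).points → EuclideanSpace ℝ (Fin 3)) (toPoint y hN i)) ≤ 357 / 100) :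
    q ∈ Set.range (toPoint y hN) := by
  rcases eq_toPoint_or_far hN q with ⟨j, rfl⟩ | hfar
  · exact ⟨j, rfl⟩
  · exfalso
    have h1 := hfar i
    have h2 : dist (y i) (q : E3) = dist ((Subtype.val : (periodiseFar y hN).points → EuclideanSpace ℝ (Fin 3)) q) ((Subtype.val : (periodiseFar y hN).points → EuclideanSpace ℝ (Fin 3)) (toPoint y hN i)) := by
      rw [dist_comm]; rfl
    linarith [Dsum_nonneg y]

/-- **The near-Barlow predicate of a motif point, read in the far periodisation, is that of
`y`** (`y` injective, any `N ≥ 1`; far-site locality at radius `357/100 < 6D + 8`).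
[folklore] -/
theorem nearBarlow_toPoint_iff {y : Fin N → E3} (hy : Function.Injective y) (hN : 0 < N)
    (i : Fin N) :
    (∃ (a c : ℝ) (s : ℤ → ℤ) (g : EuclideanSpace ℝ (Fin 3) ≃ᵃⁱ[ℝ] EuclideanSpace ℝ (Fin 3)), 93 / 100 ≤ a ∧ a ≤ 51 / 50 ∧ 78 / 100 * a ≤ c ∧ c ≤ 86 / 100 * a ∧ Literature.MathematicalPhysics.StatisticalMechanics.IsHaggSeq s ∧ (∀ j k : (periodiseFar y hN).points, j ≠ k → dist ((Subtype.val : (periodiseFar y hN).points → EuclideanSpace ℝ (Fin 3)) j) ((Subtype.val : (periodiseFar y hN).points → EuclideanSpace ℝ (Fin 3)) (toPoint y hN i)) ≤ 3 * a → a / 2 ≤ dist ((Subtype.val : (periodiseFar y hN).points → EuclideanSpace ℝ (Fin 3)) j) ((Subtype.val : (periodiseFar y hN).points → EuclideanSpace ℝ (Fin 3)) k)) ∧ (∀ j : (periodiseFar y hN).points, dist ((Subtype.val : (periodiseFar y hN).points → EuclideanSpace ℝ (Fin 3)) j) ((Subtype.val : (periodiseFar y hN).points → EuclideanSpace ℝ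 (Fin 3)) (toPoint y hN i)) ≤ 3 * a → ∃ z ∈ Literature.MathematicalPhysics.StatisticalMechanics.barlowStacking a c s, dist ((Subtype.val : (periodiseFar y hN).points → EuclideanSpace ℝ (Fin 3)) j) (g z) ≤ a / 50) ∧ (∀ z ∈ Literature.MathematicalPhysics.StatisticalMechanics.barlowStacking a c s, dist (g z) ((Subtype.val : (periodiseFar y hN).points → EuclideanSpace ℝ (Fin 3)) (toPoint y hN i)) ≤ 3 * a → ∃ j : (periodiseFar y hN).points, dist ((Subtype.val : (periodiseFar y hN).points → EuclideanSpace ℝ (Fin 3)) j) (g z) ≤ a / 50)) ↔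
      (∃ (a c : ℝ) (s : ℤ → ℤ) (g : EuclideanSpace ℝ (Fin 3) ≃ᵃⁱ[ℝ] EuclideanSpace ℝ (Fin 3)), 93 / 100 ≤ a ∧ a ≤ 51 / 50 ∧ 78 / 100 * a ≤ c ∧ c ≤ 86 / 100 * a ∧ Literature.MathematicalPhysics.StatisticalMechanics.IsHaggSeq s ∧ (∀ j k, j ≠ k → dist (y j) (y i) ≤ 3 * a → a / 2 ≤ dist (y j) (y k)) ∧ (∀ j, dist (y j) (y i) ≤ 3 * a → ∃ z ∈ Literature.MathematicalPhysics.StatisticalMechanics.barlowStacking a c s, dist (y j) (g z) ≤ a / 50) ∧ (∀ z ∈ Literature.MathematicalPhysics.StatisticalMechanics.barlowStacking a c s, dist (g z) (y i) ≤ 3 * a → ∃ j, dist (y j) (g z) ≤ a / 50)) := by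
  have hcomp : (Subtype.val : (periodiseFar y hN).points → EuclideanSpace ℝ (Fin 3)) ∘ toPoint y hN = y := funext fun _ => rfl
  have key := nearBarlow_apply_iff_comp (Subtype.val : (periodiseFar y hN).points → EuclideanSpace ℝ (Fin 3)) (toPoint_injective hy hN) i
    (fun q hq => mem_range_toPoint_of_dist_le hN i q hq)
  rw [hcomp] at key
  exact key

/-- Hence the far periodisation has exactly `#Far(y)` far motif sites. [folklore] -/
theorem motifFar_periodiseFar {y : Fin N → E3} (hy : Function.Injective y) (hN : 0 < N) :
    Nat.card {x : (periodiseFar y hN).motif // ¬ ∃ (a c : ℝ) (s : ℤ → ℤ) (g : EuclideanSpace ℝ (Fin 3) ≃ᵃⁱ[ℝ] EuclideanSpace ℝ (Fin 3)), 93 / 100 ≤ a ∧ a ≤ 51 / 50 ∧ 78 / 100 * a ≤ c ∧ c ≤ 86 / 100 * a ∧ Literature.MathematicalPhysics.StatisticalMechanics.IsHaggSeq s ∧ (∀ j k : (periodiseFar y hN).points, j ≠ k → dist ((Subtype.val : (periodiseFar y hN).points → EuclideanSpace ℝ (Fin 3)) j) ((Subtype.val : (periodiseFar y hN).points → EuclideanSpace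 ℝ (Fin 3)) ⟨x.1, (periodiseFar y hN).mem_points_of_mem_motif x.2⟩) ≤ 3 * a → a / 2 ≤ dist ((Subtype.val : (periodiseFar y hN).points → EuclideanSpace ℝ (Fin 3)) j) ((Subtype.val : (periodiseFar y hN).points → EuclideanSpace ℝ (Fin 3)) k)) ∧ (∀ j : (periodiseFar y hN).points, dist ((Subtype.val : (periodiseFar y hN).points → EuclideanSpace ℝ (Fin 3)) j) ((Subtype.val : (periodiseFar y hN).points → EuclideanSpace ℝ (Fin 3)) ⟨x.1, (periodiseFar y hN).mem_points_of_mem_motif x.2⟩) ≤ 3 * a → ∃ z ∈ Literature.MathematicalPhysics.StatisticalMechanics.barlowStacking a c s, dist ((Subtype.val : (periodiseFar y hN).points → EuclideanSpace ℝ (Fin 3)) j) (g z) ≤ a / 50) ∧ (∀ z ∈ Literature.MathematicalPhysics.StatisticalMechanics.barlowStacking a c s, dist (g z) ((Subtype.val : (periodiseFar y hN).points → EuclideanSpace ℝ (Fin 3)) ⟨x.1, (periodiseFar y hN).mem_points_of_mem_motif x.2⟩) ≤ 3 * a → ∃ j : (periodiseFar y hN).points, dist ((Subtype.val : (periodiseFar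 y hN).points → EuclideanSpace ℝ (Fin 3)) j) (g z) ≤ a / 50)} =
      Nat.card {i : Fin N // ¬ ∃ (a c : ℝ) (s : ℤ → ℤ) (g : EuclideanSpace ℝ (Fin 3) ≃ᵃⁱ[ℝ] EuclideanSpace ℝ (Fin 3)), 93 / 100 ≤ a ∧ a ≤ 51 / 50 ∧ 78 / 100 * a ≤ c ∧ c ≤ 86 / 100 * a ∧ Literature.MathematicalPhysics.StatisticalMechanics.IsHaggSeq s ∧ (∀ j k, j ≠ k → dist (y j) (y i) ≤ 3 * a → a / 2 ≤ dist (y j) (y k)) ∧ (∀ j, dist (y j) (y i) ≤ 3 * a → ∃ z ∈ Literature.MathematicalPhysics.StatisticalMechanics.barlowStacking a c s, dist (y j) (g z) ≤ a / 50) ∧ (∀ z ∈ Literature.MathematicalPhysics.StatisticalMechanics.barlowStacking a c s, dist (g z) (y i) ≤ 3 * a → ∃ j, dist (y j) (g z) ≤ a / 50)} := by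
  let f : {i : Fin N // ¬ ∃ (a c : ℝ) (s : ℤ → ℤ) (g : EuclideanSpace ℝ (Fin 3) ≃ᵃⁱ[ℝ] EuclideanSpace ℝ (Fin 3)), 93 / 100 ≤ a ∧ a ≤ 51 / 50 ∧ 78 / 100 * a ≤ c ∧ c ≤ 86 / 100 * a ∧ Literature.MathematicalPhysics.StatisticalMechanics.IsHaggSeq s ∧ (∀ j k, j ≠ k → dist (y j) (y i) ≤ 3 * a → a / 2 ≤ dist (y j) (y k)) ∧ (∀ j, dist (y j) (y i) ≤ 3 * a → ∃ z ∈ Literature.MathematicalPhysics.StatisticalMechanics.barlowStacking a c s, dist (y j) (g z) ≤ a / 50) ∧ (∀ z ∈ Literature.MathematicalPhysics.StatisticalMechanics.barlowStacking a c s, dist (g z) (y i) ≤ 3 * a → ∃ j, dist (y j) (g z) ≤ a / 50)} →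
      {x : (periodiseFar y hN).motif // ¬ ∃ (a c : ℝ) (s : ℤ → ℤ) (g : EuclideanSpace ℝ (Fin 3) ≃ᵃⁱ[ℝ] EuclideanSpace ℝ (Fin 3)), 93 / 100 ≤ a ∧ a ≤ 51 / 50 ∧ 78 / 100 * a ≤ c ∧ c ≤ 86 / 100 * a ∧ Literature.MathematicalPhysics.StatisticalMechanics.IsHaggSeq s ∧ (∀ j k : (periodiseFar y hN).points, j ≠ k → dist ((Subtype.val : (periodiseFar y hN).points → EuclideanSpace ℝ (Fin 3)) j) ((Subtype.val : (periodiseFar y hN).points → EuclideanSpace ℝ (Fin 3)) ⟨x.1, (periodiseFar y hN).mem_points_of_mem_motif x.2⟩) ≤ 3 * a → a / 2 ≤ dist ((Subtype.val : (periodiseFar y hN).points → EuclideanSpace ℝ (Fin 3)) j) ((Subtype.val : (periodiseFar y hN).points → EuclideanSpace ℝ (Fin 3)) k)) ∧ (∀ j : (periodiseFar y hN).points, dist ((Subtype.val : (periodiseFar y hN).points → EuclideanSpace ℝ (Fin 3)) j) ((Subtype.val : (periodiseFar y hN).points → EuclideanSpace ℝ (Fin 3)) ⟨x.1, (periodiseFar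 y hN).mem_points_of_mem_motif x.2⟩) ≤ 3 * a → ∃ z ∈ Literature.MathematicalPhysics.StatisticalMechanics.barlowStacking a c s, dist ((Subtype.val : (periodiseFar y hN).points → EuclideanSpace ℝ (Fin 3)) j) (g z) ≤ a / 50) ∧ (∀ z ∈ Literature.MathematicalPhysics.StatisticalMechanics.barlowStacking a c s, dist (g z) ((Subtype.val : (periodiseFar y hN).points → EuclideanSpace ℝ (Fin 3)) ⟨x.1, (periodiseFar y hN).mem_points_of_mem_motif x.2⟩) ≤ 3 * a → ∃ j : (periodiseFar y hN).points, dist ((Subtype.val : (periodiseFar y hN).points → EuclideanSpace ℝ (Fin 3)) j) (g z) ≤ a / 50)} :=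
    fun i => ⟨⟨y i.1, mem_motif_periodiseFar y hN i.1⟩, by
      have h := i.2
      rw [← nearBarlow_toPoint_iff hy hN i.1] at h
      exact h⟩
  have hf : Function.Bijective f := by
    constructor
    · intro a b hab
      have : y a.1 = y b.1 := congrArg (fun z => ((z.1 : (periodiseFar y hN).motif) : E3)) hab
      exact Subtype.ext (hy this)
    · rintro ⟨⟨v, hv⟩, hc⟩
      have hv' := hv
      rw [motif_periodiseFar] at hv'
      obtain ⟨i, -, rfl⟩ := Finset.mem_image.1 hv'
      refine ⟨⟨i, ?_⟩, rfl⟩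
      rw [← nearBarlow_toPoint_iff hy hN i]
      exact hc
  exact (Nat.card_congr (Equiv.ofBijective f hf)).symm

end FarPeriodisation

/-! ## The periodic far-site pricing ⇒ (FAR) (far periodisation) -/

/-- **The periodic far-site pricing implies the Barlow far-site gap** (same `κ`): far
periodisation for `N ≥ 1` (its far motif sites are those of `y`, its energy per particle is
exactly `E_χ(y)/N`); `N = 0` is trivial. [folklore] -/
theorem farSiteGap_of_periodicFarPricing : (∃ κ : ℝ, 0 < κ ∧ ∀ Q : Literature.MathematicalPhysics.StatisticalMechanics.PeriodicConfiguration 3, κ * (Nat.card {x : Q.motif // ¬ ∃ (a c : ℝ) (s : ℤ → ℤ) (g : EuclideanSpace ℝ (Fin 3) ≃ᵃⁱ[ℝ] EuclideanSpace ℝ (Fin 3)), 93 / 100 ≤ a ∧ a ≤ 51 / 50 ∧ 78 / 100 * a ≤ c ∧ c ≤ 86 / 100 * a ∧ Literature.MathematicalPhysics.StatisticalMechanics.IsHaggSeq s ∧ (∀ j k : Q.points, j ≠ k → dist ((Subtype.val : Q.points → EuclideanSpace ℝ (Fin 3)) j) ((Subtype.val : Q.points → EuclideanSpace ℝ (Fin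 3)) ⟨x.1, Q.mem_points_of_mem_motif x.2⟩) ≤ 3 * a → a / 2 ≤ dist ((Subtype.val : Q.points → EuclideanSpace ℝ (Fin 3)) j) ((Subtype.val : Q.points → EuclideanSpace ℝ (Fin 3)) k)) ∧ (∀ j : Q.points, dist ((Subtype.val : Q.points → EuclideanSpace ℝ (Fin 3)) j) ((Subtype.val : Q.points → EuclideanSpace ℝ (Fin 3)) ⟨x.1, Q.mem_points_of_mem_motif x.2⟩) ≤ 3 * a → ∃ z ∈ Literature.MathematicalPhysics.StatisticalMechanics.barlowStacking a c s, dist ((Subtype.val : Q.points → EuclideanSpace ℝ (Fin 3)) j) (g z) ≤ a / 50) ∧ (∀ z ∈ Literature.MathematicalPhysics.StatisticalMechanics.barlowStacking a c s, dist (g z) ((Subtype.val : Q.points → EuclideanSpace ℝ (Fin 3)) ⟨x.1, Q.mem_points_of_mem_motif x.2⟩) ≤ 3 * a → ∃ j : Q.points, dist ((Subtype.val : Q.points → EuclideanSpace ℝ (Fin 3)) j) (g z) ≤ a / 50)} : ℝ) ≤ (Q.motif.card : ℝ) * (Q.energyPerParticle (fun r => min 1 (max 0 (4 - 2 * r)) *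 Literature.MathematicalPhysics.StatisticalMechanics.lennardJones r) - ⨅ Q' : Literature.MathematicalPhysics.StatisticalMechanics.PeriodicConfiguration 3, Q'.energyPerParticle (fun r => min 1 (max 0 (4 - 2 * r)) * Literature.MathematicalPhysics.StatisticalMechanics.lennardJones r))) → (∃ κ : ℝ, 0 < κ ∧ ∀ (N : ℕ) (y : Fin N → EuclideanSpace ℝ (Fin 3)), Function.Injective y → (N : ℝ) * (⨅ Q : Literature.MathematicalPhysics.StatisticalMechanics.PeriodicConfiguration 3, Q.energyPerParticle (fun r => min 1 (max 0 (4 - 2 * r)) * Literature.MathematicalPhysics.StatisticalMechanics.lennardJones r)) + κ * (Nat.card {i : Fin N // ¬ ∃ (a c : ℝ) (s : ℤ → ℤ) (g : EuclideanSpace ℝ (Fin 3) ≃ᵃⁱ[ℝ] EuclideanSpace ℝ (Fin 3)), 93 / 100 ≤ a ∧ a ≤ 51 / 50 ∧ 78 / 100 * a ≤ c ∧ c ≤ 86 / 100 * a ∧ Literature.MathematicalPhysics.StatisticalMechanics.IsHaggSeq s ∧ (∀ j k : Fin N, j ≠ k → dist (y j) (y i) ≤ 3 * a → a / 2 ≤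 dist (y j) (y k)) ∧ (∀ j : Fin N, dist (y j) (y i) ≤ 3 * a → ∃ z ∈ Literature.MathematicalPhysics.StatisticalMechanics.barlowStacking a c s, dist (y j) (g z) ≤ a / 50) ∧ (∀ z ∈ Literature.MathematicalPhysics.StatisticalMechanics.barlowStacking a c s, dist (g z) (y i) ≤ 3 * a → ∃ j : Fin N, dist (y j) (g z) ≤ a / 50)} : ℝ) ≤ Literature.MathematicalPhysics.StatisticalMechanics.interactionEnergy (fun r => min 1 (max 0 (4 - 2 * r)) * Literature.MathematicalPhysics.StatisticalMechanics.lennardJones r) y) := by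
  rintro ⟨κ, hκ, h⟩
  refine ⟨κ, hκ, fun N y hy => ?_⟩
  rcases Nat.eq_zero_or_pos N with rfl | hN0
  · rw [Nat.card_of_isEmpty, interactionEnergy_of_subsingleton]
    simp
  · have hp := h (periodiseFar y hN0)
    rw [motifFar_periodiseFar hy hN0] at hp
    have hcard : (((periodiseFar y hN0).motif.card : ℕ) : ℝ) = N := by
      rw [motif_periodiseFar, Finset.card_image_of_injective _ hy, Finset.card_univ,
        Fintype.card_fin]
    have he : (periodiseFar y hN0).energyPerParticle
        (fun r => min 1 (max 0 (4 - 2 * r)) * lennardJones r) =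
        interactionEnergy (fun r => min 1 (max 0 (4 - 2 * r)) * lennardJones r) y / N :=
      energyPerParticle_periodiseFar_eq_div truncLJ_eq_zero_of_two_le (by norm_num) hy hN0
    rw [hcard, he] at hp
    -- hide the far count and the energy behind opaque names before the arithmetic
    generalize (Nat.card {i : Fin N // ¬ ∃ (a c : ℝ) (s : ℤ → ℤ) (g : EuclideanSpace ℝ (Fin 3) ≃ᵃⁱ[ℝ] EuclideanSpace ℝ (Fin 3)), 93 / 100 ≤ a ∧ a ≤ 51 / 50 ∧ 78 / 100 * a ≤ c ∧ c ≤ 86 / 100 * a ∧ Literature.MathematicalPhysics.StatisticalMechanics.IsHaggSeq s ∧ (∀ j k : Fin N, j ≠ k → dist (y j) (y i) ≤ 3 * a → a / 2 ≤ dist (y j) (y k)) ∧ (∀ j : Fin N, dist (y j) (y i) ≤ 3 * a → ∃ z ∈ Literature.MathematicalPhysics.StatisticalMechanics.barlowStacking a c s, dist (y j) (g z) ≤ a / 50) ∧ (∀ z ∈ Literature.MathematicalPhysics.StatisticalMechanics.barlowStacking a c s, dist (g z) (y i) ≤ 3 * a → ∃ j : Fin N, dist (y j) (g z) ≤ a /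 50)} : ℝ) = m at hp ⊢
    generalize interactionEnergy (fun r => min 1 (max 0 (4 - 2 * r)) * lennardJones r) y = E
      at hp ⊢
    have hNr : (0 : ℝ) < N := by exact_mod_cast hN0
    have hmul : (N : ℝ) * (E / N) = E := by field_simp
    rw [mul_sub, hmul] at hp
    linarith

/-! ## The equivalence, and two consequences -/

/-- **The Barlow far-site gap (FAR) is EQUIVALENT to the periodic far-site pricing for `V_χ`**
(the FAR-twin of `truncatedCensusGap_iff_periodicPricing` and of
`underCoordinationGap_iff_periodicUnderPricing`): the precise open content of the stub
`stub_barlowFarSiteGap` — finite-range periodic crystallization for `V_χ` in coarse, priced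
form. [folklore] -/
theorem farSiteGap_iff_periodicFarPricing : (∃ κ : ℝ, 0 < κ ∧ ∀ (N : ℕ) (y : Fin N → EuclideanSpace ℝ (Fin 3)), Function.Injective y → (N : ℝ) * (⨅ Q : Literature.MathematicalPhysics.StatisticalMechanics.PeriodicConfiguration 3, Q.energyPerParticle (fun r => min 1 (max 0 (4 - 2 * r)) * Literature.MathematicalPhysics.StatisticalMechanics.lennardJones r)) + κ * (Nat.card {i : Fin N // ¬ ∃ (a c : ℝ) (s : ℤ → ℤ) (g : EuclideanSpace ℝ (Fin 3) ≃ᵃⁱ[ℝ] EuclideanSpace ℝ (Fin 3)), 93 / 100 ≤ a ∧ a ≤ 51 / 50 ∧ 78 / 100 * a ≤ c ∧ c ≤ 86 / 100 * a ∧ Literature.MathematicalPhysics.StatisticalMechanics.IsHaggSeq s ∧ (∀ j k : Fin N, j ≠ k → dist (y j) (y i) ≤ 3 * a → a / 2 ≤ dist (y j) (y k)) ∧ (∀ j : Fin N, dist (y j) (y i) ≤ 3 * a → ∃ z ∈ Literature.MathematicalPhysics.StatisticalMechanics.barlowStacking a c s, dist (y j) (g z) ≤ a / 50) ∧ (∀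 z ∈ Literature.MathematicalPhysics.StatisticalMechanics.barlowStacking a c s, dist (g z) (y i) ≤ 3 * a → ∃ j : Fin N, dist (y j) (g z) ≤ a / 50)} : ℝ) ≤ Literature.MathematicalPhysics.StatisticalMechanics.interactionEnergy (fun r => min 1 (max 0 (4 - 2 * r)) * Literature.MathematicalPhysics.StatisticalMechanics.lennardJones r) y) ↔ (∃ κ : ℝ, 0 < κ ∧ ∀ Q : Literature.MathematicalPhysics.StatisticalMechanics.PeriodicConfiguration 3, κ * (Nat.card {x : Q.motif // ¬ ∃ (a c : ℝ) (s : ℤ → ℤ) (g : EuclideanSpace ℝ (Fin 3) ≃ᵃⁱ[ℝ] EuclideanSpace ℝ (Fin 3)), 93 / 100 ≤ a ∧ a ≤ 51 / 50 ∧ 78 / 100 * a ≤ c ∧ c ≤ 86 / 100 * a ∧ Literature.MathematicalPhysics.StatisticalMechanics.IsHaggSeq s ∧ (∀ j k : Q.points, j ≠ k → dist ((Subtype.val : Q.points → EuclideanSpace ℝ (Fin 3)) j) ((Subtype.val : Q.points → EuclideanSpace ℝ (Fin 3)) ⟨x.1, Q.mem_points_of_mem_motif x.2⟩) ≤ 3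 * a → a / 2 ≤ dist ((Subtype.val : Q.points → EuclideanSpace ℝ (Fin 3)) j) ((Subtype.val : Q.points → EuclideanSpace ℝ (Fin 3)) k)) ∧ (∀ j : Q.points, dist ((Subtype.val : Q.points → EuclideanSpace ℝ (Fin 3)) j) ((Subtype.val : Q.points → EuclideanSpace ℝ (Fin 3)) ⟨x.1, Q.mem_points_of_mem_motif x.2⟩) ≤ 3 * a → ∃ z ∈ Literature.MathematicalPhysics.StatisticalMechanics.barlowStacking a c s, dist ((Subtype.val : Q.points → EuclideanSpace ℝ (Fin 3)) j) (g z) ≤ a / 50) ∧ (∀ z ∈ Literature.MathematicalPhysics.StatisticalMechanics.barlowStacking a c s, dist (g z) ((Subtype.val : Q.points → EuclideanSpace ℝ (Fin 3)) ⟨x.1, Q.mem_points_of_mem_motif x.2⟩) ≤ 3 * a → ∃ j : Q.points, dist ((Subtype.val : Q.points → EuclideanSpace ℝ (Fin 3)) j) (g z) ≤ a / 50)} : ℝ) ≤ (Q.motif.card : ℝ) * (Q.energyPerParticle (fun r => min 1 (max 0 (4 - 2 * r)) * Literature.MathematicalPhysics.StatisticalMechanics.lennardJones r) - ⨅ Q'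 : Literature.MathematicalPhysics.StatisticalMechanics.PeriodicConfiguration 3, Q'.energyPerParticle (fun r => min 1 (max 0 (4 - 2 * r)) * Literature.MathematicalPhysics.StatisticalMechanics.lennardJones r))) :=
  ⟨periodicFarPricing_of_farSiteGap, farSiteGap_of_periodicFarPricing⟩

/-- **Kill criterion for (FAR).**  Under the Barlow far-site gap, a periodic configuration with
at least one FAR motif site (read in the infinite point set `Q.points`) lies STRICTLY above the
periodic infimum: `e_χ* < e_χ(Q)`.  Contrapositive: a periodic `V_χ`-minimiser with a far site
(a site whose `3a`-patch is not coarsely Barlow for any `a ∈ [0.93, 1.02]`,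
`c/a ∈ [0.78, 0.86]`) refutes (FAR), hence the line. [folklore] -/
theorem lt_energyPerParticle_of_motifFar
    (hFar : ∃ κ : ℝ, 0 < κ ∧ ∀ (N : ℕ) (y : Fin N → EuclideanSpace ℝ (Fin 3)), Function.Injective y → (N : ℝ) * (⨅ Q : Literature.MathematicalPhysics.StatisticalMechanics.PeriodicConfiguration 3, Q.energyPerParticle (fun r => min 1 (max 0 (4 - 2 * r)) * Literature.MathematicalPhysics.StatisticalMechanics.lennardJones r)) + κ * (Nat.card {i : Fin N // ¬ ∃ (a c : ℝ) (s : ℤ → ℤ) (g : EuclideanSpace ℝ (Fin 3) ≃ᵃⁱ[ℝ] EuclideanSpace ℝ (Fin 3)), 93 / 100 ≤ a ∧ a ≤ 51 / 50 ∧ 78 / 100 * a ≤ c ∧ c ≤ 86 / 100 * a ∧ Literature.MathematicalPhysics.StatisticalMechanics.IsHaggSeq s ∧ (∀ j k : Fin N, j ≠ k → dist (y j) (y i) ≤ 3 * a → a / 2 ≤ dist (y j) (y k)) ∧ (∀ j : Fin N, dist (y j) (y i) ≤ 3 * a → ∃ z ∈ Literature.MathematicalPhysics.StatisticalMechanics.barlowStacking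 a c s, dist (y j) (g z) ≤ a / 50) ∧ (∀ z ∈ Literature.MathematicalPhysics.StatisticalMechanics.barlowStacking a c s, dist (g z) (y i) ≤ 3 * a → ∃ j : Fin N, dist (y j) (g z) ≤ a / 50)} : ℝ) ≤ Literature.MathematicalPhysics.StatisticalMechanics.interactionEnergy (fun r => min 1 (max 0 (4 - 2 * r)) * Literature.MathematicalPhysics.StatisticalMechanics.lennardJones r) y)
    (Q : PeriodicConfiguration 3)
    (hQ : 0 < Nat.card {x : Q.motif // ¬ ∃ (a c : ℝ) (s : ℤ → ℤ) (g : EuclideanSpace ℝ (Fin 3) ≃ᵃⁱ[ℝ] EuclideanSpace ℝ (Fin 3)), 93 / 100 ≤ a ∧ a ≤ 51 / 50 ∧ 78 / 100 * a ≤ c ∧ c ≤ 86 / 100 * a ∧ Literature.MathematicalPhysics.StatisticalMechanics.IsHaggSeq s ∧ (∀ j k : Q.points, j ≠ k → dist ((Subtype.val : Q.points → EuclideanSpace ℝ (Fin 3)) j) ((Subtype.val : Q.points → EuclideanSpace ℝ (Fin 3)) ⟨x.1, Q.mem_points_of_mem_motif x.2⟩) ≤ 3 * a → a / 2 ≤ dist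 ((Subtype.val : Q.points → EuclideanSpace ℝ (Fin 3)) j) ((Subtype.val : Q.points → EuclideanSpace ℝ (Fin 3)) k)) ∧ (∀ j : Q.points, dist ((Subtype.val : Q.points → EuclideanSpace ℝ (Fin 3)) j) ((Subtype.val : Q.points → EuclideanSpace ℝ (Fin 3)) ⟨x.1, Q.mem_points_of_mem_motif x.2⟩) ≤ 3 * a → ∃ z ∈ Literature.MathematicalPhysics.StatisticalMechanics.barlowStacking a c s, dist ((Subtype.val : Q.points → EuclideanSpace ℝ (Fin 3)) j) (g z) ≤ a / 50) ∧ (∀ z ∈ Literature.MathematicalPhysics.StatisticalMechanics.barlowStacking a c s, dist (g z) ((Subtype.val : Q.points → EuclideanSpace ℝ (Fin 3)) ⟨x.1, Q.mem_points_of_mem_motif x.2⟩) ≤ 3 * a → ∃ j : Q.points, dist ((Subtype.val : Q.points → EuclideanSpace ℝ (Fin 3)) j) (g z) ≤ a / 50)}) :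
    (⨅ Q' : PeriodicConfiguration 3,
        Q'.energyPerParticle (fun r => min 1 (max 0 (4 - 2 * r)) * lennardJones r)) <
      Q.energyPerParticle (fun r => min 1 (max 0 (4 - 2 * r)) * lennardJones r) := by
  obtain ⟨κ, hκ, hp⟩ := periodicFarPricing_of_farSiteGap hFar
  have h1 := hp Q
  revert h1 hQ
  generalize Nat.card {x : Q.motif // ¬ ∃ (a c : ℝ) (s : ℤ → ℤ) (g : EuclideanSpace ℝ (Fin 3) ≃ᵃⁱ[ℝ] EuclideanSpace ℝ (Fin 3)), 93 / 100 ≤ a ∧ a ≤ 51 / 50 ∧ 78 / 100 * a ≤ c ∧ c ≤ 86 / 100 * a ∧ Literature.MathematicalPhysics.StatisticalMechanics.IsHaggSeq s ∧ (∀ j k : Q.points, j ≠ k → dist ((Subtype.val : Q.points → EuclideanSpace ℝ (Fin 3)) j) ((Subtype.val : Q.points → EuclideanSpace ℝ (Fin 3)) ⟨x.1, Q.mem_points_of_mem_motif x.2⟩) ≤ 3 * a → a / 2 ≤ dist ((Subtype.val : Q.points → EuclideanSpace ℝ (Fin 3)) j) ((Subtype.val : Q.points → EuclideanSpace ℝ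 (Fin 3)) k)) ∧ (∀ j : Q.points, dist ((Subtype.val : Q.points → EuclideanSpace ℝ (Fin 3)) j) ((Subtype.val : Q.points → EuclideanSpace ℝ (Fin 3)) ⟨x.1, Q.mem_points_of_mem_motif x.2⟩) ≤ 3 * a → ∃ z ∈ Literature.MathematicalPhysics.StatisticalMechanics.barlowStacking a c s, dist ((Subtype.val : Q.points → EuclideanSpace ℝ (Fin 3)) j) (g z) ≤ a / 50) ∧ (∀ z ∈ Literature.MathematicalPhysics.StatisticalMechanics.barlowStacking a c s, dist (g z) ((Subtype.val : Q.points → EuclideanSpace ℝ (Fin 3)) ⟨x.1, Q.mem_points_of_mem_motif x.2⟩) ≤ 3 * a → ∃ j : Q.points, dist ((Subtype.val : Q.points → EuclideanSpace ℝ (Fin 3)) j) (g z) ≤ a / 50)} = m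
  intro hQ h1
  have hF : (0 : ℝ) < Q.motif.card := by exact_mod_cast Q.motif_nonempty.card_pos
  have hm : (1 : ℝ) ≤ m := by exact_mod_cast hQ
  have hpos : 0 < κ * (m : ℝ) := mul_pos hκ (by linarith)
  by_contra hle
  push Not at hle
  have : (Q.motif.card : ℝ) * (Q.energyPerParticle (fun r => min 1 (max 0 (4 - 2 * r)) * lennardJones r) -
      ⨅ Q' : PeriodicConfiguration 3,
        Q'.energyPerParticle (fun r => min 1 (max 0 (4 - 2 * r)) * lennardJones r)) ≤ 0 :=
    mul_nonpos_of_nonneg_of_nonpos hF.le (by linarith)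
  linarith

/-- **Uniform gap for everywhere-far periodic configurations.**  (FAR) yields `κ > 0` such
that every periodic configuration ALL of whose motif sites are far in `Q.points` satisfies
`e_χ* + κ ≤ e_χ(Q)`: periodic structures that are nowhere coarsely Barlow (at the tolerances
of the line) are uniformly gapped above the periodic infimum. [folklore] -/
theorem le_energyPerParticle_of_forall_motifFar
    (hFar : ∃ κ : ℝ, 0 < κ ∧ ∀ (N : ℕ) (y : Fin N → EuclideanSpace ℝ (Fin 3)), Function.Injective y → (N : ℝ) * (⨅ Q : Literature.MathematicalPhysics.StatisticalMechanics.PeriodicConfiguration 3, Q.energyPerParticle (fun r => min 1 (max 0 (4 - 2 * r)) * Literature.MathematicalPhysics.StatisticalMechanics.lennardJones r)) + κ * (Nat.card {i : Fin N // ¬ ∃ (a c : ℝ) (s : ℤ → ℤ) (g : EuclideanSpace ℝ (Fin 3) ≃ᵃⁱ[ℝ] EuclideanSpace ℝ (Fin 3)), 93 / 100 ≤ a ∧ a ≤ 51 / 50 ∧ 78 / 100 * a ≤ c ∧ c ≤ 86 / 100 * a ∧ Literature.MathematicalPhysics.StatisticalMechanics.IsHaggSeq s ∧ (∀ j k : Fin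 N, j ≠ k → dist (y j) (y i) ≤ 3 * a → a / 2 ≤ dist (y j) (y k)) ∧ (∀ j : Fin N, dist (y j) (y i) ≤ 3 * a → ∃ z ∈ Literature.MathematicalPhysics.StatisticalMechanics.barlowStacking a c s, dist (y j) (g z) ≤ a / 50) ∧ (∀ z ∈ Literature.MathematicalPhysics.StatisticalMechanics.barlowStacking a c s, dist (g z) (y i) ≤ 3 * a → ∃ j : Fin N, dist (y j) (g z) ≤ a / 50)} : ℝ) ≤ Literature.MathematicalPhysics.StatisticalMechanics.interactionEnergy (fun r => min 1 (max 0 (4 - 2 * r)) * Literature.MathematicalPhysics.StatisticalMechanics.lennardJones r) y) :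
    ∃ κ : ℝ, 0 < κ ∧ ∀ Q : PeriodicConfiguration 3,
      (∀ x : Q.motif, ¬ ∃ (a c : ℝ) (s : ℤ → ℤ) (g : EuclideanSpace ℝ (Fin 3) ≃ᵃⁱ[ℝ] EuclideanSpace ℝ (Fin 3)), 93 / 100 ≤ a ∧ a ≤ 51 / 50 ∧ 78 / 100 * a ≤ c ∧ c ≤ 86 / 100 * a ∧ Literature.MathematicalPhysics.StatisticalMechanics.IsHaggSeq s ∧ (∀ j k : Q.points, j ≠ k → dist ((Subtype.val : Q.points → EuclideanSpace ℝ (Fin 3)) j) ((Subtype.val : Q.points → EuclideanSpace ℝ (Fin 3)) ⟨x.1, Q.mem_points_of_mem_motif x.2⟩) ≤ 3 * a → a / 2 ≤ dist ((Subtype.val : Q.points → EuclideanSpace ℝ (Fin 3)) j) ((Subtype.val : Q.points → EuclideanSpace ℝ (Fin 3)) k)) ∧ (∀ j : Q.points, dist ((Subtype.val : Q.points → EuclideanSpace ℝ (Fin 3)) j) ((Subtype.val : Q.points → EuclideanSpace ℝ (Fin 3)) ⟨x.1, Q.mem_points_of_mem_motif x.2⟩) ≤ 3 * a → ∃ z ∈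 Literature.MathematicalPhysics.StatisticalMechanics.barlowStacking a c s, dist ((Subtype.val : Q.points → EuclideanSpace ℝ (Fin 3)) j) (g z) ≤ a / 50) ∧ (∀ z ∈ Literature.MathematicalPhysics.StatisticalMechanics.barlowStacking a c s, dist (g z) ((Subtype.val : Q.points → EuclideanSpace ℝ (Fin 3)) ⟨x.1, Q.mem_points_of_mem_motif x.2⟩) ≤ 3 * a → ∃ j : Q.points, dist ((Subtype.val : Q.points → EuclideanSpace ℝ (Fin 3)) j) (g z) ≤ a / 50)) →
      (⨅ Q' : PeriodicConfiguration 3,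
          Q'.energyPerParticle (fun r => min 1 (max 0 (4 - 2 * r)) * lennardJones r)) + κ ≤
        Q.energyPerParticle (fun r => min 1 (max 0 (4 - 2 * r)) * lennardJones r) := by
  obtain ⟨κ, hκ, hp⟩ := periodicFarPricing_of_farSiteGap hFar
  refine ⟨κ, hκ, fun Q hall => ?_⟩
  have h1 := hp Q
  have hcard : Nat.card {x : Q.motif // ¬ ∃ (a c : ℝ) (s : ℤ → ℤ) (g : EuclideanSpace ℝ (Fin 3) ≃ᵃⁱ[ℝ] EuclideanSpace ℝ (Fin 3)), 93 / 100 ≤ a ∧ a ≤ 51 / 50 ∧ 78 / 100 * a ≤ c ∧ c ≤ 86 / 100 * a ∧ Literature.MathematicalPhysics.StatisticalMechanics.IsHaggSeq s ∧ (∀ j k : Q.points, j ≠ k → dist ((Subtype.val : Q.points → EuclideanSpace ℝ (Fin 3)) j) ((Subtype.val : Q.points → EuclideanSpace ℝ (Fin 3)) ⟨x.1, Q.mem_points_of_mem_motif x.2⟩) ≤ 3 * a → a / 2 ≤ dist ((Subtype.val : Q.points → EuclideanSpace ℝ (Fin 3)) j) ((Subtype.val : Q.points → EuclideanSpace ℝ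 (Fin 3)) k)) ∧ (∀ j : Q.points, dist ((Subtype.val : Q.points → EuclideanSpace ℝ (Fin 3)) j) ((Subtype.val : Q.points → EuclideanSpace ℝ (Fin 3)) ⟨x.1, Q.mem_points_of_mem_motif x.2⟩) ≤ 3 * a → ∃ z ∈ Literature.MathematicalPhysics.StatisticalMechanics.barlowStacking a c s, dist ((Subtype.val : Q.points → EuclideanSpace ℝ (Fin 3)) j) (g z) ≤ a / 50) ∧ (∀ z ∈ Literature.MathematicalPhysics.StatisticalMechanics.barlowStacking a c s, dist (g z) ((Subtype.val : Q.points → EuclideanSpace ℝ (Fin 3)) ⟨x.1, Q.mem_points_of_mem_motif x.2⟩) ≤ 3 * a → ∃ j : Q.points, dist ((Subtype.val : Q.points → EuclideanSpace ℝ (Fin 3)) j) (g z) ≤ a / 50)} = Q.motif.card := by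
    rw [Nat.card_congr (Equiv.subtypeUnivEquiv hall), Nat.card_eq_fintype_card,
      Fintype.card_coe]
  rw [hcard] at h1
  have hF : (0 : ℝ) < Q.motif.card := by exact_mod_cast Q.motif_nonempty.card_pos
  by_contra hlt
  push Not at hlt
  have : (Q.motif.card : ℝ) * (Q.energyPerParticle (fun r => min 1 (max 0 (4 - 2 * r)) * lennardJones r) -
      ⨅ Q' : PeriodicConfiguration 3,
        Q'.energyPerParticle (fun r => min 1 (max 0 (4 - 2 * r)) * lennardJones r)) <
      (Q.motif.card : ℝ) * κ :=
    mul_lt_mul_of_pos_left (by linarith) hF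
  linarith

end Summit.AtomisticToContinuum.Crystallization.Theorems.PricedLinkCensusTruncatedCensusGap

end
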